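import Literature.Probability.LatticeModels.PlaneRotatorTransitionCouplings
import Mathlib.MeasureTheory.Integral.Bochner.Set
import Mathlib.Topology.Semicontinuity.Basic
import HarnessLib

/-!
# The high-temperature phase of the plane-rotator comparison model is open in the coupling:
# `χ(K_χ) = ∞` at the transition coupling itself (every dimension, and the layered stack), and
# `Δ ↦ K_χ^{3D}(Δ)` is lower semicontinuous (so `T_χ^{3D}(J∥, ΔJ∥)` is upper semicontinuous)

Topic `Literature/Probability/LatticeModels`. Lieb's finite algorithm (E. H. Lieb, Comm. Math. Phys. **77** (1980) 127,
Theorem 4 and p. 128: "one can, in principle, compute `β_c` to arbitrary accuracy") terminates on a box `[−R, R]^ν`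
exactly when ONE finite-dimensional integral, the box number `S_R(K)`, is `< 1`; with Simon's summation
(B. Simon, Comm. Math. Phys. **77** (1980) 111, Thm 1.3) the tree proves `χ(K) < ∞ ⇔ ∃ R, S_R(K) < 1` in every dimension
(`summable_infTwoPoint_iff_exists_cube_lt_one`) and for the layered stack
(`summable_layered_iff_exists_cube_lt_one`). This file adds the one analytic input those files leave implicit —
**`K ↦ S_R(K)` is continuous** (a finite sum of Gibbs expectations on the compact torus `U(1)^{box}`, continuous in
the couplings by the continuity of parametric integrals of jointly continuous integrands over a compact space; the
partition function is positive) — and draws the consequences for the typed transition couplings of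
`PlaneRotatorTransitionCouplings.lean`:

* `continuous_ginibreExpect_torus`, `PlaneRotator.continuous_twoPoint` — the finite-volume Gibbs expectation
  `⟨F⟩_J` and the two-point function `⟨cos(θ_a − θ_b)⟩_J` are continuous functions of the coupling array `J`;
  `continuous_nnBoxShellSum` (`K ↦ S_R(K)`), `continuous_layeredCube` (`(K∥, K⊥) ↦ S_{(R,R,R)}(1; K∥, K⊥)`).
* **Openness**: `exists_gt_summable_infTwoPoint` — if `χ(K) < ∞` then `χ(K') < ∞` for some `K' > K`; hence the
  SHARP EXACT form of the phase **`summable_infTwoPoint_iff_ofReal_lt`: `χ(K) < ∞ ↔ K < K_χ(ν)`** (`0 ≤ K`), i.e. the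
  high-temperature phase is the half-open interval `[0, K_χ(ν))` and **`χ(K_χ(ν)) = ∞` whenever `K_χ(ν) < ∞`**
  (`not_summable_infTwoPoint_toReal_susceptibilityCriticalCoupling`): the transition coupling belongs to the
  low-temperature phase. Under Fröhlich–Spencer's Theorem C (named hypothesis) this is an actual coupling of the
  square lattice.
* **Layered stack**: joint openness in `(K∥, K⊥)` (`exists_nhds_summable_layered`), the sharp exact form
  `summable_layered_iff_ofReal_lt`, `χ^{3D} = ∞` at `K_χ^{3D}(Δ)`, and **lower semicontinuity of
  `Δ ↦ K_χ^{3D}(Δ)` on `[0, ∞)`** (`lowerSemicontinuousWithinAt_layeredSusceptibilityCriticalCoupling`), which with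
  antitonicity gives **right-continuity in `Δ`**; in temperature units `Δ ↦ T_χ^{3D}(J∥, ΔJ∥) = J∥/K_χ^{3D}(Δ)` is
  upper semicontinuous and right-continuous (nothing is claimed about left limits: a downward jump of `K_χ^{3D}`
  as `Δ` increases is not excluded by anything in the tree).

Cell `pub/hubbard-tc` (MO-S3; G2 2D→3D ordering lemma ∕ K2 register typing; lead ruling R93), classical comparison
model only, number-neutral. WHAT THIS IS NOT: no value of any transition coupling; not continuity of `K_χ^{3D}` in `Δ`;
not `Υ_∞ > 0` anywhere; nothing about the Hubbard model or a material.
-/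

noncomputable section

open MeasureTheory Finset Filter Topology
open scoped BigOperators ENNReal

namespace Literature.Probability.LatticeModels

/-! ## §1 Gibbs expectations on the torus `U(1)^V` are continuous in the couplings -/

section GinibreContinuity

variable {V : Type*} [Fintype V] [MeasurableSpace Circle] [BorelSpace Circle] {ι : Type*} [Fintype ι]

omit [Fintype V] [MeasurableSpace Circle] [BorelSpace Circle] in
/-- The Gibbs weight `exp(∑ₐ Jₐ Re χₐ(θ))` is jointly continuous in `(J, θ)`. [cite: Ginibre1970, main theorem with the plane-rotator example cos(m·φ)] -/
theorem continuous_ginibreWeight_uncurry (χ : ι → (V → Circle) →ₜ* Circle) :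
    Continuous fun p : (ι → ℝ) × (V → Circle) => ginibreWeight χ p.1 p.2 := by
  unfold ginibreWeight ginibreHamiltonian
  refine Real.continuous_exp.comp (continuous_finsetSum _ fun a _ => ?_)
  exact ((continuous_apply a).comp continuous_fst).mul ((continuous_reChar (χ a)).comp continuous_snd)

/-- **The numerator `∫ F·e^{∑ Jₐ Re χₐ} dθ` is continuous in the couplings** for continuous `F` — a parametric integral of
a jointly continuous integrand over the compact torus (Mathlib `continuous_parametric_integral_of_continuous`).
[cite: Ginibre1970, main theorem with the plane-rotator example cos(m·φ); Lieb1980, p. 128 (φ(β): one finite-dimensional integral)] -/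
theorem continuous_integral_mul_ginibreWeight (χ : ι → (V → Circle) →ₜ* Circle) {F : (V → Circle) → ℝ}
    (hF : Continuous F) :
    Continuous fun J : ι → ℝ => ∫ θ, F θ * ginibreWeight χ J θ ∂(torusHaar V) := by
  have h := continuous_parametric_integral_of_continuous (μ := torusHaar V)
    (f := fun (J : ι → ℝ) (θ : V → Circle) => F θ * ginibreWeight χ J θ)
    ((hF.comp continuous_snd).mul (continuous_ginibreWeight_uncurry χ)) isCompact_univ
  simpa only [Measure.restrict_univ] using h

/-- The partition function `∫ e^{∑ Jₐ Re χₐ} dθ > 0`. [cite: Ginibre1970, main theorem with the plane-rotator example cos(m·φ)] -/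
theorem integral_ginibreWeight_torus_pos (χ : ι → (V → Circle) →ₜ* Circle) (J : ι → ℝ) :
    0 < ∫ θ, ginibreWeight χ J θ ∂(torusHaar V) :=
  integral_exp_pos (integrable_of_continuous_compactSpace _ (continuous_ginibreWeight χ J))

/-- **The Gibbs expectation `⟨F⟩_J` on the torus is a continuous function of the coupling array `J`** (continuous `F`):
quotient of two continuous parametric integrals, the denominator positive.
[cite: Ginibre1970, main theorem with the plane-rotator example cos(m·φ); Lieb1980, p. 128 (one finite-dimensional integral)] -/
theorem continuous_ginibreExpect_torus (χ : ι → (V → Circle) →ₜ* Circle) {F : (V → Circle) → ℝ}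
    (hF : Continuous F) : Continuous fun J : ι → ℝ => ginibreExpect (torusHaar V) χ J F := by
  unfold ginibreExpect
  have hD : Continuous fun J : ι → ℝ => ∫ θ, ginibreWeight χ J θ ∂(torusHaar V) := by
    have h := continuous_integral_mul_ginibreWeight (V := V) χ (continuous_const (y := (1 : ℝ)))
    simpa only [one_mul] using h
  exact (continuous_integral_mul_ginibreWeight χ hF).div hD fun J => (integral_ginibreWeight_torus_pos χ J).ne'

end GinibreContinuity

namespace PlaneRotator

open Literature.Barriers.CriticalPhenomena Literature.Barriers.CriticalPhenomena.LongRangeIsing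

/-! ## §2 The two-point function and Lieb's box numbers are continuous in the coupling -/

section BoxContinuity

variable [MeasurableSpace Circle] [BorelSpace Circle]

/-- **`J ↦ ⟨cos(θ_a − θ_b)⟩_{V,J}` is continuous** on the whole coupling space `V × V → ℝ`.
[cite: Ginibre1970, Example 4 (plane rotators, cos(m·φ)); Lieb1980, p. 128 (one finite-dimensional integral)] -/
theorem continuous_twoPoint {V : Type*} [Fintype V] (a b : V) : Continuous fun J : V × V → ℝ => twoPoint J a b := by
  unfold twoPoint
  exact continuous_ginibreExpect_torus (pairChars V) (continuous_cosDiff a b)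

variable {ν : ℕ}

/-- Lieb's box number `S_R(Jf)` depends continuously on a continuously parametrised pair coupling `t ↦ Jf_t`.
[cite: Lieb1980, p. 128 (φ(β) < 1 for a box: one finite-dimensional integral)] -/
theorem continuous_boxShellSum_comp {X : Type*} [TopologicalSpace X] {Jf : X → Site ν → Site ν → ℝ}
    (hJ : ∀ x y, Continuous fun t => Jf t x y) (R : ℕ) : Continuous fun t => boxShellSum (Jf t) R := by
  unfold boxShellSum
  refine continuous_finsetSum _ fun b _ => ?_
  have hc : Continuous fun t => refCoupling (Jf t) R := continuous_pi fun p => by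
    unfold refCoupling
    split_ifs
    · exact continuous_const
    · exact hJ _ _
  exact (continuous_twoPoint (refCentre ν R) b).comp hc

/-- **`K ↦ S_R(K)` is continuous**: the box number of the nearest-neighbour plane rotator on `ℤ^ν` at reduced coupling
`K` (Lieb's `φ(β)` for the box `[−R, R]^ν`). [cite: Lieb1980, Theorem 4 and p. 128 (boxes; finite algorithm)] -/
theorem continuous_nnBoxShellSum (R : ℕ) : Continuous fun K : ℝ => nnBoxShellSum K ν R := by
  unfold nnBoxShellSum
  exact continuous_boxShellSum_comp (fun x y => (continuous_id.div_const 2).mul continuous_const) R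

/-- The anisotropic box number `S_{Rv}(Jf)` depends continuously on a continuously parametrised pair coupling.
[cite: Lieb1980, p. 128 (φ(β) for a box: one finite-dimensional integral)] -/
theorem continuous_aboxShellSum_comp {X : Type*} [TopologicalSpace X] {Jf : X → Site ν → Site ν → ℝ}
    (hJ : ∀ x y, Continuous fun t => Jf t x y) (Rv : Fin ν → ℕ) : Continuous fun t => aboxShellSum (Jf t) Rv := by
  unfold aboxShellSum
  refine continuous_finsetSum _ fun b _ => ?_
  have hc : Continuous fun t => aRefCoupling (Jf t) Rv := continuous_pi fun p => by
    unfold aRefCoupling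
    split_ifs
    · exact continuous_const
    · exact hJ _ _
  exact (continuous_twoPoint (aCentre Rv) b).comp hc

/-- **`(K∥, K⊥) ↦ S_{(R,R,R)}(β; K∥, K⊥)` is jointly continuous**: the cube number of the layered stack
(`LayeredPlaneRotatorSusceptibilityDichotomy.lean`). [cite: Lieb1980, p. 128 (boxes; finite algorithm); LiuStanley1972, p. 272 (layers (J, J, εJ))] -/
theorem continuous_layeredCube (β : ℝ) (R : ℕ) :
    Continuous fun p : ℝ × ℝ =>
      aboxShellSum (fun u v : Site 3 => β / 2 * layeredCoupling p.1 p.2 u v) (fun _ : Fin 3 => R) := by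
  refine continuous_aboxShellSum_comp (fun x y => continuous_const.mul ?_) _
  unfold layeredCoupling
  split_ifs
  · exact continuous_fst
  · exact continuous_snd
  · exact continuous_const

end BoxContinuity

/-! ## §3 The high-temperature phase `{χ < ∞}` is open; `χ(K_χ) = ∞` -/

section Open

variable [MeasurableSpace Circle] [BorelSpace Circle] {ν : ℕ}

/-- **Openness of the finite-susceptibility phase (every dimension).** If `χ(K) = ∑_x G_K(0,x) < ∞` (`K ≥ 0`) then
`χ(K') < ∞` for some `K' > K`: a terminating box `S_R(K) < 1` (Simon–Lieb) still terminates at slightly larger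
coupling by continuity of `S_R`. Lieb's finite algorithm is an OPEN condition.
[cite: Lieb1980, Theorem 4 and p. 128 (boxes; finite algorithm); Simon1980CMP, Thm 1.3] -/
theorem exists_gt_summable_infTwoPoint {K : ℝ} (hK : 0 ≤ K) (hG : Summable fun x : Site ν => infTwoPoint K ν 0 x) :
    ∃ K' : ℝ, K < K' ∧ Summable fun x : Site ν => infTwoPoint K' ν 0 x := by
  obtain ⟨R, hR, hS⟩ := exists_nnBoxShellSum_lt_one_of_summable hK hG
  have hev : ∀ᶠ K' in 𝓝 K, nnBoxShellSum K' ν R < 1 :=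
    (continuous_nnBoxShellSum (ν := ν) R).continuousAt.eventually (gt_mem_nhds hS)
  obtain ⟨ε, hε, hball⟩ := Metric.eventually_nhds_iff.1 hev
  refine ⟨K + ε / 2, by linarith, summable_infTwoPoint_of_cube_lt_one (by linarith) hR (hball ?_)⟩
  rw [Real.dist_eq, show K + ε / 2 - K = ε / 2 by ring, abs_of_pos (half_pos hε)]
  exact half_lt_self hε

/-- Every coupling of the high-temperature phase lies STRICTLY below the transition coupling: `χ(K) < ∞ ⇒ K < K_χ(ν)`.
[cite: Lieb1980, Theorem 4 and p. 128; Simon1980CMP, Thm 1.3] -/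
theorem ofReal_lt_susceptibilityCriticalCoupling_of_summable {K : ℝ} (hK : 0 ≤ K)
    (hG : Summable fun x : Site ν => infTwoPoint K ν 0 x) :
    ENNReal.ofReal K < susceptibilityCriticalCoupling ν := by
  obtain ⟨K', hKK', hG'⟩ := exists_gt_summable_infTwoPoint hK hG
  exact ((ENNReal.ofReal_lt_ofReal_iff_of_nonneg hK).2 hKK').trans_le
    (ofReal_le_susceptibilityCriticalCoupling (hK.trans hKK'.le) hG')

/-- **The high-temperature phase is exactly the half-open interval `[0, K_χ(ν))`**: for `K ≥ 0`,
`χ(K) < ∞ ↔ K < K_χ(ν)`. [cite: Lieb1980, Theorem 4 and p. 128 (boxes; finite algorithm); Simon1980CMP, Thm 1.3] -/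
theorem summable_infTwoPoint_iff_ofReal_lt {K : ℝ} (hK : 0 ≤ K) :
    (Summable fun x : Site ν => infTwoPoint K ν 0 x) ↔ ENNReal.ofReal K < susceptibilityCriticalCoupling ν :=
  ⟨ofReal_lt_susceptibilityCriticalCoupling_of_summable hK, summable_infTwoPoint_of_ofReal_lt hK⟩

/-- The same as an identity of sets: `{K ≥ 0 : χ(K) < ∞} = {K ≥ 0 : K < K_χ(ν)}` — relatively open in `[0, ∞)`
(`ENNReal.ofReal` is continuous). [cite: Lieb1980, p. 128 (boxes; finite algorithm); Simon1980CMP, Thm 1.3] -/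
theorem setOf_summable_infTwoPoint_eq :
    {K : ℝ | 0 ≤ K ∧ Summable fun x : Site ν => infTwoPoint K ν 0 x} =
      Set.Ici 0 ∩ ENNReal.ofReal ⁻¹' Set.Iio (susceptibilityCriticalCoupling ν) := by
  ext K
  simp only [Set.mem_setOf_eq, Set.mem_inter_iff, Set.mem_Ici, Set.mem_preimage, Set.mem_Iio]
  exact ⟨fun h => ⟨h.1, (summable_infTwoPoint_iff_ofReal_lt h.1).1 h.2⟩,
    fun h => ⟨h.1, (summable_infTwoPoint_iff_ofReal_lt h.1).2 h.2⟩⟩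

omit [MeasurableSpace Circle] [BorelSpace Circle] in
/-- `{K : K < c}` pulled back along `ENNReal.ofReal` is open in `ℝ`. [folklore] -/
private theorem isOpen_preimage_ofReal_Iio (c : ℝ≥0∞) : IsOpen (ENNReal.ofReal ⁻¹' Set.Iio c) :=
  ENNReal.continuous_ofReal.isOpen_preimage _ isOpen_Iio

/-- **The high-temperature phase is relatively open in `[0, ∞)`**: it is the trace on `[0, ∞)` of an open subset of `ℝ`.
[cite: Lieb1980, p. 128 (boxes; finite algorithm: an open condition); Simon1980CMP, Thm 1.3] -/
theorem exists_isOpen_setOf_summable_infTwoPoint :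
    ∃ U : Set ℝ, IsOpen U ∧ {K : ℝ | 0 ≤ K ∧ Summable fun x : Site ν => infTwoPoint K ν 0 x} = Set.Ici 0 ∩ U :=
  ⟨_, isOpen_preimage_ofReal_Iio _, setOf_summable_infTwoPoint_eq⟩

/-- **At the transition coupling itself the susceptibility is infinite**: if `K_χ(ν) < ∞` then
`χ(K_χ(ν)) = ∑_x G_{K_χ}(0, x) = ∞` — the supremum of the (open) high-temperature phase is not attained; the
transition coupling belongs to the low-temperature phase. [cite: Lieb1980, Theorem 4 and p. 128 (β ≥ β_c ⇒ φ(β) ≥ 1 for every box); Simon1980CMP, Thm 1.3] -/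
theorem not_summable_infTwoPoint_toReal_susceptibilityCriticalCoupling (h : susceptibilityCriticalCoupling ν ≠ ⊤) :
    ¬ Summable fun x : Site ν => infTwoPoint (susceptibilityCriticalCoupling ν).toReal ν 0 x := fun hG =>
  (ofReal_lt_susceptibilityCriticalCoupling_of_summable ENNReal.toReal_nonneg hG).ne (ENNReal.ofReal_toReal h)

/-- … and Lieb's algorithm does not terminate there: `S_R(K_χ) ≥ 1` for every `R ≥ 1` (if `K_χ(ν) < ∞`).
[cite: Lieb1980, Theorem 4 and p. 128 (β ≥ β_c ⇒ φ(β) ≥ 1 for every box)] -/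
theorem one_le_nnBoxShellSum_toReal_susceptibilityCriticalCoupling (h : susceptibilityCriticalCoupling ν ≠ ⊤)
    {R : ℕ} (hR : 1 ≤ R) : 1 ≤ nnBoxShellSum (susceptibilityCriticalCoupling ν).toReal ν R := by
  by_contra hlt
  exact not_summable_infTwoPoint_toReal_susceptibilityCriticalCoupling h
    (summable_infTwoPoint_of_cube_lt_one ENNReal.toReal_nonneg hR (lt_of_not_ge hlt))

/-- **Square lattice, conditional on Fröhlich–Spencer's Theorem C**: the transition coupling `K_χ(2)` is finite, so
there IS a coupling — `K_χ(2)` itself, `log(1+√2) ≤ K_χ(2) ≤ K₁` — at which the free susceptibility of the two-dimensional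
plane rotator is infinite while it is finite at every smaller coupling. CONDITIONAL on the named fact.
[cite: FrohlichSpencerKT1981, §1.4 Theorem C (p. 534); Lieb1980, p. 128] -/
theorem FrohlichSpencerPowerLawLowerBound.not_summable_at_transition (hFS : FrohlichSpencerPowerLawLowerBound) :
    ¬ Summable fun x : Site 2 => infTwoPoint (susceptibilityCriticalCoupling 2).toReal 2 0 x :=
  not_summable_infTwoPoint_toReal_susceptibilityCriticalCoupling hFS.susceptibilityCriticalCoupling_two_lt_top.ne

end Open

/-! ## §4 The layered stack: joint openness in `(K∥, K⊥)`, `χ^{3D} = ∞` at `K_χ^{3D}(Δ)`, lower semicontinuity in `Δ` -/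

section LayeredOpen

variable [MeasurableSpace Circle] [BorelSpace Circle]

/-- **Joint openness of the stack's finite-susceptibility phase.** If `∑_z G^{3D}_{(1; K∥, K⊥)}(0, z) < ∞`
(`K∥, K⊥ ≥ 0`) then there is `ε > 0` such that every stack with `0 ≤ K∥' < K∥ + ε`, `0 ≤ K⊥' < K⊥ + ε` has finite
susceptibility (continuity of the cube number `S_{(R,R,R)}` in `(K∥, K⊥)` + Griffiths–Ginibre downward inheritance).
[cite: Lieb1980, Theorem 4 and p. 128 (boxes; finite algorithm); Simon1980CMP, Thm 1.3; LiuStanley1972, p. 272] -/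
theorem exists_nhds_summable_layered {Kp Kz : ℝ} (hp : 0 ≤ Kp) (hz : 0 ≤ Kz)
    (hG : Summable fun z : Site 3 => infTwoPointLayered 1 Kp Kz 0 z) :
    ∃ ε : ℝ, 0 < ε ∧ ∀ ⦃Kp' Kz' : ℝ⦄, 0 ≤ Kp' → 0 ≤ Kz' → Kp' < Kp + ε → Kz' < Kz + ε →
      Summable fun z : Site 3 => infTwoPointLayered 1 Kp' Kz' 0 z := by
  obtain ⟨R, hR, hS⟩ := (summable_layered_iff_exists_cube_lt_one zero_le_one hp hz).1 hG
  have hev : ∀ᶠ p : ℝ × ℝ in 𝓝 (Kp, Kz),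
      aboxShellSum (fun u v : Site 3 => 1 / 2 * layeredCoupling p.1 p.2 u v) (fun _ : Fin 3 => R) < 1 :=
    ((continuous_layeredCube 1 R).continuousAt (x := (Kp, Kz))).eventually (gt_mem_nhds hS)
  obtain ⟨ε, hε, hball⟩ := Metric.eventually_nhds_iff.1 hev
  refine ⟨ε, hε, fun Kp' Kz' hp' hz' hltp hltz => ?_⟩
  -- the componentwise maximum `q = (Kp ⊔ Kp', Kz ⊔ Kz')` is `ε`-close to `(Kp, Kz)` and dominates `(Kp', Kz')`
  have hq : dist (max Kp Kp', max Kz Kz') (Kp, Kz) < ε := by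
    rw [Prod.dist_eq, Real.dist_eq, Real.dist_eq]
    refine max_lt ?_ ?_
    · rw [abs_of_nonneg (by simp)]
      rcases le_total Kp Kp' with h | h
      · rw [max_eq_right h]; linarith
      · rw [max_eq_left h]; linarith
    · rw [abs_of_nonneg (by simp)]
      rcases le_total Kz Kz' with h | h
      · rw [max_eq_right h]; linarith
      · rw [max_eq_left h]; linarith
  have hSq := hball hq
  have hGq : Summable fun z : Site 3 => infTwoPointLayered 1 (max Kp Kp') (max Kz Kz') 0 z :=
    (summable_layered_iff_exists_cube_lt_one zero_le_one (hp.trans (le_max_left _ _))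
      (hz.trans (le_max_left _ _))).2 ⟨R, hR, hSq⟩
  exact summable_layered_of_mul_le zero_le_one hp' hz' (by rw [one_mul]; exact le_max_right _ _)
    (by rw [one_mul]; exact le_max_right _ _) hGq

/-- Every in-plane coupling of the stack's high-temperature phase lies STRICTLY below `K_χ^{3D}(Δ)` (`Δ ≥ 0`).
[cite: Lieb1980, Theorem 4 and p. 128; Simon1980CMP, Thm 1.3; LiuStanley1972, p. 272] -/
theorem ofReal_lt_layeredSusceptibilityCriticalCoupling_of_summable {Δ K : ℝ} (hΔ : 0 ≤ Δ) (hK : 0 ≤ K)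
    (hG : Summable fun z : Site 3 => infTwoPointLayered 1 K (Δ * K) 0 z) :
    ENNReal.ofReal K < layeredSusceptibilityCriticalCoupling Δ := by
  obtain ⟨ε, hε, h⟩ := exists_nhds_summable_layered hK (mul_nonneg hΔ hK) hG
  -- a small step `δ` in `K` moves `(K, ΔK)` by less than `ε` in both coordinates
  set δ : ℝ := ε / (2 * (Δ + 1)) with hδdef
  have hδ : 0 < δ := by rw [hδdef]; positivity
  have hδε : δ < ε := by
    rw [hδdef, div_lt_iff₀ (by positivity)]; nlinarith
  have hΔδ : Δ * δ < ε := by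
    rw [hδdef]
    rw [show Δ * (ε / (2 * (Δ + 1))) = ε * (Δ / (2 * (Δ + 1))) by ring]
    have : Δ / (2 * (Δ + 1)) < 1 := by rw [div_lt_one (by positivity)]; linarith
    nlinarith
  have hG' : Summable fun z : Site 3 => infTwoPointLayered 1 (K + δ) (Δ * (K + δ)) 0 z :=
    h (by linarith) (mul_nonneg hΔ (by linarith)) (by linarith) (by rw [mul_add]; linarith)
  exact ((ENNReal.ofReal_lt_ofReal_iff_of_nonneg hK).2 (by linarith)).trans_le
    (ofReal_le_layeredSusceptibilityCriticalCoupling (by linarith) hG')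

/-- **The stack's high-temperature phase at anisotropy `Δ ≥ 0` is exactly `[0, K_χ^{3D}(Δ))`**:
`∑_z G^{3D}_{(1; K, ΔK)}(0, z) < ∞ ↔ K < K_χ^{3D}(Δ)` (`K ≥ 0`). [cite: Lieb1980, Theorem 4 and p. 128 (boxes; finite algorithm); Simon1980CMP, Thm 1.3; LiuStanley1972, p. 272] -/
theorem summable_layered_iff_ofReal_lt {Δ K : ℝ} (hΔ : 0 ≤ Δ) (hK : 0 ≤ K) :
    (Summable fun z : Site 3 => infTwoPointLayered 1 K (Δ * K) 0 z) ↔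
      ENNReal.ofReal K < layeredSusceptibilityCriticalCoupling Δ :=
  ⟨ofReal_lt_layeredSusceptibilityCriticalCoupling_of_summable hΔ hK, summable_layered_of_ofReal_lt hΔ hK⟩

/-- **At the stack's transition coupling the susceptibility is infinite**: if `K_χ^{3D}(Δ) < ∞` (`Δ ≥ 0`) then
`∑_z G^{3D}_{(1; K_χ^{3D}(Δ), Δ·K_χ^{3D}(Δ))}(0, z) = ∞`. [cite: Lieb1980, Theorem 4 and p. 128 (β ≥ β_c ⇒ φ(β) ≥ 1 for every box); Simon1980CMP, Thm 1.3] -/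
theorem not_summable_layered_toReal_layeredSusceptibilityCriticalCoupling {Δ : ℝ} (hΔ : 0 ≤ Δ)
    (h : layeredSusceptibilityCriticalCoupling Δ ≠ ⊤) :
    ¬ Summable fun z : Site 3 => infTwoPointLayered 1 (layeredSusceptibilityCriticalCoupling Δ).toReal
      (Δ * (layeredSusceptibilityCriticalCoupling Δ).toReal) 0 z := fun hG =>
  (ofReal_lt_layeredSusceptibilityCriticalCoupling_of_summable hΔ ENNReal.toReal_nonneg hG).ne
    (ENNReal.ofReal_toReal h)

/-- **`Δ ↦ K_χ^{3D}(Δ)` is lower semicontinuous on `[0, ∞)`**: every in-plane coupling of the high-temperature phase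
at anisotropy `Δ` stays in the high-temperature phase for all nearby anisotropies `Δ' ≥ 0` (joint openness), so
`liminf_{Δ' → Δ} K_χ^{3D}(Δ') ≥ K_χ^{3D}(Δ)`. [cite: Lieb1980, p. 128 (finite algorithm: an open condition); LiuStanley1972, p. 272 (T_c(ε)); Simon1980CMP, Thm 1.3] -/
theorem lowerSemicontinuousWithinAt_layeredSusceptibilityCriticalCoupling {Δ : ℝ} (hΔ : 0 ≤ Δ) :
    LowerSemicontinuousWithinAt layeredSusceptibilityCriticalCoupling (Set.Ici 0) Δ := by
  intro y hy
  unfold layeredSusceptibilityCriticalCoupling at hy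
  obtain ⟨K₀, hK₀⟩ := lt_iSup_iff.1 hy
  obtain ⟨⟨hK₀0, hG⟩, hlt⟩ := lt_iSup_iff.1 hK₀
  obtain ⟨ε, hε, h⟩ := exists_nhds_summable_layered hK₀0 (mul_nonneg hΔ hK₀0) hG
  -- for `Δ'` near `Δ`, `Δ'·K₀ < Δ·K₀ + ε`
  have hsmall : ∀ᶠ Δ' : ℝ in 𝓝 Δ, Δ' * K₀ < Δ * K₀ + ε := by
    have ht : Tendsto (fun Δ' : ℝ => Δ' * K₀) (𝓝 Δ) (𝓝 (Δ * K₀)) := (tendsto_id (x := 𝓝 Δ)).mul_const K₀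
    exact ht.eventually (gt_mem_nhds (by linarith))
  filter_upwards [hsmall.filter_mono nhdsWithin_le_nhds, self_mem_nhdsWithin] with Δ' hΔ'ε hΔ'0
  have hG' : Summable fun z : Site 3 => infTwoPointLayered 1 K₀ (Δ' * K₀) 0 z :=
    h hK₀0 (mul_nonneg (Set.mem_Ici.1 hΔ'0) hK₀0) (by linarith) hΔ'ε
  exact hlt.trans_le (ofReal_le_layeredSusceptibilityCriticalCoupling hK₀0 hG')

/-- `K_χ^{3D}` is lower semicontinuous on `[0, ∞)`. [cite: Lieb1980, p. 128 (finite algorithm: an open condition); LiuStanley1972, p. 272] -/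
theorem lowerSemicontinuousOn_layeredSusceptibilityCriticalCoupling :
    LowerSemicontinuousOn layeredSusceptibilityCriticalCoupling (Set.Ici 0) :=
  fun _ hΔ => lowerSemicontinuousWithinAt_layeredSusceptibilityCriticalCoupling (Set.mem_Ici.1 hΔ)

/-- **Right-continuity of `K_χ^{3D}` in the anisotropy**: for `Δ ≥ 0`, `K_χ^{3D}(Δ') → K_χ^{3D}(Δ)` as `Δ' ↓ Δ`
(antitone + lower semicontinuous). Nothing is claimed from the left: a downward jump of `K_χ^{3D}` at some `Δ` is not
excluded by anything in the tree. [cite: LiuStanley1972, p. 272 (T_c(ε)); Lieb1980, p. 128; Ginibre1970, Prop. 3 with Example 4 (plane rotators)] -/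
theorem continuousWithinAt_Ici_layeredSusceptibilityCriticalCoupling {Δ : ℝ} (hΔ : 0 ≤ Δ) :
    ContinuousWithinAt layeredSusceptibilityCriticalCoupling (Set.Ici Δ) Δ := by
  refine tendsto_order.2 ⟨fun a ha => ?_, fun b hb => ?_⟩
  · have h := lowerSemicontinuousWithinAt_layeredSusceptibilityCriticalCoupling hΔ a ha
    exact h.filter_mono (nhdsWithin_mono _ (Set.Ici_subset_Ici.2 hΔ))
  · filter_upwards [self_mem_nhdsWithin] with Δ' hΔ'
    exact (layeredSusceptibilityCriticalCoupling_antitoneOn (Set.mem_Ici.2 hΔ)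
      (Set.mem_Ici.2 (hΔ.trans (Set.mem_Ici.1 hΔ'))) (Set.mem_Ici.1 hΔ')).trans_lt hb

/-- At `Δ = 0` this is continuity from the right at the decoupled point, `K_χ^{3D}(Δ') → K_χ^{3D}(0) = K_χ(2)` as
`Δ' ↓ 0` — the tree's `tendsto_layeredSusceptibilityCriticalCoupling_zero` again, now as an instance of right-continuity.
[cite: LiuStanley1972, p. 272 (T_c(ε) → T_c^{2D} as ε → 0)] -/
theorem continuousWithinAt_Ici_layeredSusceptibilityCriticalCoupling_zero :
    ContinuousWithinAt layeredSusceptibilityCriticalCoupling (Set.Ici 0) 0 :=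
  continuousWithinAt_Ici_layeredSusceptibilityCriticalCoupling le_rfl

/-! ### Temperature forms: `T_χ^{3D}(J∥, ΔJ∥) = J∥/K_χ^{3D}(Δ)` is upper semicontinuous and right-continuous in `Δ` -/

omit [MeasurableSpace Circle] [BorelSpace Circle] in
/-- `x ↦ c/x` is continuous on `[0, ∞]` for finite `c`. [folklore] -/
private theorem continuous_const_div_ennreal (J : ℝ) : Continuous fun x : ℝ≥0∞ => ENNReal.ofReal J / x := by
  simp_rw [div_eq_mul_inv]
  exact (ENNReal.continuous_const_mul ENNReal.ofReal_ne_top).comp continuous_inv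

omit [MeasurableSpace Circle] [BorelSpace Circle] in
/-- `x ↦ c/x` is antitone on `[0, ∞]`. [folklore] -/
private theorem antitone_const_div_ennreal (J : ℝ) : Antitone fun x : ℝ≥0∞ => ENNReal.ofReal J / x :=
  fun _ _ hxy => ENNReal.div_le_div_left hxy _

/-- **`Δ ↦ T_χ^{3D}(J∥, ΔJ∥)` is upper semicontinuous on `[0, ∞)`** (`T_χ^{3D}(J∥, ΔJ∥) := J∥/K_χ^{3D}(Δ)`, the
extended-real quotient): the composition of the lower semicontinuous `K_χ^{3D}` with the continuous antitone `x ↦ J∥/x`.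
[cite: LiuStanley1972, p. 272 (T_c(ε)); Lieb1980, p. 128 (finite algorithm: an open condition)] -/
theorem upperSemicontinuousWithinAt_layeredSusceptibilityTemperature (J : ℝ) {Δ : ℝ} (hΔ : 0 ≤ Δ) :
    UpperSemicontinuousWithinAt (fun Δ' => ENNReal.ofReal J / layeredSusceptibilityCriticalCoupling Δ') (Set.Ici 0) Δ :=
  (continuous_const_div_ennreal J).continuousAt.comp_lowerSemicontinuousWithinAt_antitone
    (lowerSemicontinuousWithinAt_layeredSusceptibilityCriticalCoupling hΔ) (antitone_const_div_ennreal J)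

/-- **Right-continuity of `T_χ^{3D}(J∥, ΔJ∥)` in `Δ`** at every `Δ ≥ 0` (in particular at `Δ = 0`:
`T_χ^{3D}(J∥, ΔJ∥) ↓ T_χ^{2D}(J∥)`). [cite: LiuStanley1972, p. 272 (T_c(ε) → T_c^{2D} as ε → 0); Lieb1980, p. 128] -/
theorem continuousWithinAt_Ici_layeredSusceptibilityTemperature (J : ℝ) {Δ : ℝ} (hΔ : 0 ≤ Δ) :
    ContinuousWithinAt (fun Δ' => ENNReal.ofReal J / layeredSusceptibilityCriticalCoupling Δ') (Set.Ici Δ) Δ :=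
  ENNReal.Tendsto.const_div (continuousWithinAt_Ici_layeredSusceptibilityCriticalCoupling hΔ)
    (Or.inr ENNReal.ofReal_ne_top)

end LayeredOpen

/-! ### At the canonical Borel structure on `Circle`: the infrared-bound range `0 < Δ ≤ 1`

The ceiling `K_χ^{3D}(Δ) ≤ C(Δ)` of `PlaneRotatorTransitionCouplings.lean` is stated at the tree's global instance
`GrassmannIntegral.instMeasurableSpace` (where the torus plateau lives), hence so is this corollary. -/

section AtBorel

/-- In the infrared-bound range `0 < Δ ≤ 1` the stack's transition coupling IS finite (`K_χ^{3D}(Δ) ≤ C(Δ)`), so the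
previous statement is unconditional there: at `K = K_χ^{3D}(Δ)` the stack's free susceptibility is infinite.
[cite: FILS1978, Thm. 4.7 with (4.7)–(4.10); Lieb1980, p. 128; Simon1980CMP, Thm 1.3] -/
theorem not_summable_layered_at_transition {Δ : ℝ} (hΔ0 : 0 < Δ) (hΔ1 : Δ ≤ 1) :
    ¬ Summable fun z : Site 3 => infTwoPointLayered 1 (layeredSusceptibilityCriticalCoupling Δ).toReal
      (Δ * (layeredSusceptibilityCriticalCoupling Δ).toReal) 0 z :=
  not_summable_layered_toReal_layeredSusceptibilityCriticalCoupling hΔ0.le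
    ((layeredSusceptibilityCriticalCoupling_le_klsConstant hΔ0 hΔ1).trans_lt ENNReal.ofReal_lt_top).ne

end AtBorel

end PlaneRotator

end Literature.Probability.LatticeModels

end
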